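import Summits.CriticalPhenomena.PercolationContinuityZ3.Theorems.PercNearOneGluingNoHeavyLowerTailSahiHittingBoxRecursive
import HarnessLib

/-!
# `NoHeavyLowerTail` (stmt-CriticalPhenomena-4575) — free-slot region reduction at order 4: the 7-variable node polynomials,
# the 1 691 up-closed families, the checker, and their real semantics

Support file, seat `prim-l12-p5` (gen 17), `--supports stmt-CriticalPhenomena-4575`.  Standard axioms, no sorries, no named facts; computable list data
(run by `native_decide` in `…SahiFreeSlotFourCert`) and the soundness lemmas that turn the Boolean check into real inequalities.
Memo FROM-prim-l12-p5-g17-FREE-SLOT-REGION-REDUCTION §1(v)–(vi).  Objects (7 Venn regions of three slots, `regs`; nodes = sets `R` of open regions):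
* list polynomials in the region closed-probabilities `r : Fin 7 → ℝ`: `PK R` (cell mass `∏ (1−r_i | r_i)`), `mK W` (moments `Σ_{W ⊆ patt R} P_R`), `c..K`
  (covariances), `E3K`, `zWK W` (the value of the first-slot density `Z` on the hit pattern `W`), all normalised by `normK` (sort–merge–drop, value-preserving);
* `defNodes` (the 19 nodes whose pattern is not everything), `families` (= the up-closed subsets of `defNodes`, as sublists), `inU` (membership in
  `𝒟 ∪ N(𝒟)`), `nuK` (the polynomial `ν_𝒟 = Σ_W z_W · Σ_{R ∈ 𝒟∪N(𝒟), patt R = W} P_R`), `checkFam` (degree guard + `boxcheckK`), **`checkAll`**;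
* semantics: `evalKL_normK`, `evalKL_PK` (`= cellProb r R`), `evalKL_mK`, `evalKL_zWK`, `evalKL_nuK` (a `Finset` sum over `{R | inU 𝒟 R}`), and
  `nuK_nonneg_of_checkFam`. [this work]
-/

namespace Summit.CriticalPhenomena.PercolationContinuityZ3.Theorems

namespace SahiFreeSlot

open Finset SahiHitting

/-! ## Regions, patterns, nodes -/

/-- The seven Venn regions of three slots, as the sets of slots they belong to (order `0,1,2,01,02,12,012`). [this work] -/
def regs : Fin 7 → Finset (Fin 3) := ![{0}, {1}, {2}, {0, 1}, {0, 2}, {1, 2}, {0, 1, 2}]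

/-- The hit pattern of a set of open regions: the slots met by some open region. [this work] -/
def patt (R : Finset (Fin 7)) : Finset (Fin 3) := R.biUnion regs

/-- All 128 nodes (sets of regions), as a list. [this work] -/
def allNodes : List (Finset (Fin 7)) := ((List.finRange 7).sublists).map List.toFinset

/-- All 8 patterns (subsets of the three slots), as a list. [this work] -/
def allPatts : List (Finset (Fin 3)) := ((List.finRange 3).sublists).map List.toFinset

/-- The 19 DEFICIENT nodes: hit pattern not everything. [this work] -/
def defNodes : List (Finset (Fin 7)) := allNodes.filter fun R => patt R ≠ Finset.univ

/-! ## List polynomials in the 7 region variables -/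

/-- Exponent list of the variable `x_i`. [this work] -/
def unitE (i : Fin 7) : List ℕ := (List.finRange 7).map fun j => if j = i then 1 else 0

/-- The zero exponent list. [this work] -/
def zeroE : List ℕ := (List.finRange 7).map fun _ => 0

/-- The polynomial `x_i`. [this work] -/
def XK (i : Fin 7) : List (ℤ × List ℕ) := [(1, unitE i)]

/-- The polynomial `1`. [this work] -/
def oneK : List (ℤ × List ℕ) := [(1, zeroE)]

/-- The polynomial `1 − x_i`. [this work] -/
def oneSubXK (i : Fin 7) : List (ℤ × List ℕ) := [(1, zeroE), (-1, unitE i)]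

/-- Normal form of a term list: sort by key hash, merge adjacent equal keys, drop zero coefficients (value-preserving). [this work] -/
def normK (L : List (ℤ × List ℕ)) : List (ℤ × List ℕ) :=
  dropZeroK (mergeAdj (((L.map fun t => (hashL t.2, t)).mergeSort fun a b => Nat.ble a.1 b.1).map fun p => p.2))

/-- The cell-mass polynomial `P_R = ∏_i (1 − x_i if i ∈ R, else x_i)`. [this work] -/
def PK (R : Finset (Fin 7)) : List (ℤ × List ℕ) :=
  prodK ((List.finRange 7).map fun i => if i ∈ R then oneSubXK i else XK i)

/-- The moment polynomial `m_W = Σ_{R : W ⊆ patt R} P_R` (probability that every slot of `W` is hit). [this work] -/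
def mK (W : Finset (Fin 3)) : List (ℤ × List ℕ) := normK (sumK ((allNodes.filter fun R => W ⊆ patt R).map PK))

/-- `m_{0}`. [this work] -/
def m0K : List (ℤ × List ℕ) := mK {0}
/-- `m_{1}`. [this work] -/
def m1K : List (ℤ × List ℕ) := mK {1}
/-- `m_{2}`. [this work] -/
def m2K : List (ℤ × List ℕ) := mK {2}
/-- `m_{01}`. [this work] -/
def m01K : List (ℤ × List ℕ) := mK {0, 1}
/-- `m_{02}`. [this work] -/
def m02K : List (ℤ × List ℕ) := mK {0, 2}
/-- `m_{12}`. [this work] -/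
def m12K : List (ℤ × List ℕ) := mK {1, 2}
/-- `m_{012}`. [this work] -/
def m012K : List (ℤ × List ℕ) := mK {0, 1, 2}
/-- `Cov(h_1,h_2)`. [this work] -/
def c12K : List (ℤ × List ℕ) := normK (m12K ++ pnegK (pmulK m1K m2K))
/-- `Cov(h_0,h_2)`. [this work] -/
def c02K : List (ℤ × List ℕ) := normK (m02K ++ pnegK (pmulK m0K m2K))
/-- `Cov(h_0,h_1)`. [this work] -/
def c01K : List (ℤ × List ℕ) := normK (m01K ++ pnegK (pmulK m0K m1K))
/-- Sahi's `E_3(h_0,h_1,h_2)` of the three hit slots. [this work] -/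
def E3K : List (ℤ × List ℕ) := normK (sumK [pscaleK 2 m012K, pnegK (pmulK m0K m12K), pnegK (pmulK m1K m02K),
  pnegK (pmulK m2K m01K), pmulK m0K (pmulK m1K m2K)])

/-- Integer indicator `[W' ⊆ W]`. [this work] -/
def gamW (W' W : Finset (Fin 3)) : ℤ := if W' ⊆ W then 1 else 0

/-- The value `z_W` of the first-slot density on the hit pattern `W`:
`6[W=O] − 2Σ_k [O∖k ⊆ W] m_k − Σ_j [{j} ⊆ W] Cov_{O∖j} − E_3`. [this work] -/
def zWK (W : Finset (Fin 3)) : List (ℤ × List ℕ) :=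
  normK (sumK [pscaleK (6 * gamW {0, 1, 2} W) oneK, pscaleK (-2 * gamW {1, 2} W) m0K, pscaleK (-2 * gamW {0, 2} W) m1K,
    pscaleK (-2 * gamW {0, 1} W) m2K, pscaleK (-gamW {0} W) c12K, pscaleK (-gamW {1} W) c02K, pscaleK (-gamW {2} W) c01K, pnegK E3K])

/-! ## Families and the checker -/

/-- `𝒟` (a list of deficient nodes) is up-closed inside the deficient nodes. [this work] -/
def upClosedDef (D : List (Finset (Fin 7))) : Bool :=
  D.all fun R => defNodes.all fun R' => !(decide (R ⊆ R')) || decide (R' ∈ D)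

/-- The up-closed families of deficient nodes (1 691 sublists of `defNodes`). [this work] -/
def families : List (List (Finset (Fin 7))) := defNodes.sublists.filter upClosedDef

/-- Membership in `𝒟 ∪ N(𝒟)`: in `𝒟`, or a full node above some element of `𝒟`. [this work] -/
def inU (D : List (Finset (Fin 7))) (R : Finset (Fin 7)) : Bool :=
  decide (R ∈ D) || (decide (patt R = Finset.univ) && D.any fun R0 => decide (R0 ⊆ R))

/-- Declared (variable, degree) pairs for the Bernstein slicing: multidegree `(2,2,2,3,3,3,4)`. [this work] -/
def vs7 : List (ℕ × ℕ) := [(0, 2), (1, 2), (2, 2), (3, 3), (4, 3), (5, 3), (6, 4)]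

/-- Degree guard: every exponent within the declared multidegree. [this work] -/
def degOK (L : List (ℤ × List ℕ)) : Bool := L.all fun t => vs7.all fun vd => decide (t.2.getD vd.1 0 ≤ vd.2)

/-- The pattern group sum `S_W(𝒟) = Σ_{R ∈ 𝒟∪N(𝒟), patt R = W} P_R`. [this work] -/
def groupSum (D : List (Finset (Fin 7))) (W : Finset (Fin 3)) : List (ℤ × List ℕ) :=
  normK (sumK ((allNodes.filter fun R => inU D R && decide (patt R = W)).map PK))

/-- The family polynomial `ν_𝒟 = Σ_W z_W · S_W(𝒟)`. [this work] -/
def nuK (D : List (Finset (Fin 7))) : List (ℤ × List ℕ) :=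
  normK (sumK (allPatts.map fun W => pmulK (zWK W) (groupSum D W)))

/-- The check of one family: degree guard and pruned Bernstein slicing (`boxcheckK`). [this work] -/
def checkFam (D : List (Finset (Fin 7))) : Bool :=
  degOK (nuK D) && boxcheckK vs7 (nuK D)

/-- **The whole certificate**: `z_O ≥ 0` on the box and `ν_𝒟 ≥ 0` for all 1 691 up-closed families. [this work] -/
def checkAll : Bool :=
  (decide allNodes.Nodup && decide allPatts.Nodup) &&
    ((degOK (zWK Finset.univ) && boxcheckK vs7 (zWK Finset.univ)) && families.all checkFam)

/-! ## Real semantics -/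

/-- The cell mass as a real function: `∏_i (1 − r_i if i ∈ R, else r_i)`. [this work] -/
noncomputable def cellProb (r : Fin 7 → ℝ) (R : Finset (Fin 7)) : ℝ := ∏ i, (if i ∈ R then 1 - r i else r i)

/-- `cellProb ≥ 0` on the box. [this work] -/
theorem cellProb_nonneg {r : Fin 7 → ℝ} (hr : ∀ i, 0 ≤ r i ∧ r i ≤ 1) (R : Finset (Fin 7)) : 0 ≤ cellProb r R :=
  prod_nonneg fun i _ => by split_ifs <;> linarith [hr i]

/-- `normK` preserves the value. [this work] -/
theorem evalKL_normK (L : List (ℤ × List ℕ)) (x : Fin 7 → ℝ) : evalKL 7 (normK L) x = evalKL 7 L x := by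
  rw [normK, evalKL_dropZeroK, evalKL_mergeAdj]
  have hp : (((L.map fun t => (hashL t.2, t)).mergeSort fun a b => Nat.ble a.1 b.1).map fun p => p.2).Perm L := by
    have h1 := (List.mergeSort_perm (L.map fun t => (hashL t.2, t)) fun a b => Nat.ble a.1 b.1).map fun p => p.2
    rw [List.map_map] at h1
    have h2 : ((fun p : ℕ × (ℤ × List ℕ) => p.2) ∘ fun t : ℤ × List ℕ => (hashL t.2, t)) = id := rfl
    rw [h2, List.map_id] at h1
    exact h1
  exact evalKL_perm hp x

/-- Value of `x_i`. [this work] -/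
theorem evalKL_XK (i : Fin 7) (x : Fin 7 → ℝ) : evalKL 7 (XK i) x = x i := by
  fin_cases i <;> simp [evalKL, XK, unitE, List.finRange, Fin.prod_univ_seven]

/-- Value of `1`. [this work] -/
theorem evalKL_oneK (x : Fin 7 → ℝ) : evalKL 7 oneK x = 1 := by
  simp [evalKL, oneK, zeroE, List.finRange, Fin.prod_univ_seven]

/-- Value of `1 − x_i`. [this work] -/
theorem evalKL_oneSubXK (i : Fin 7) (x : Fin 7 → ℝ) : evalKL 7 (oneSubXK i) x = 1 - x i := by
  fin_cases i <;> simp [evalKL, oneSubXK, unitE, zeroE, List.finRange, Fin.prod_univ_seven] <;> ring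

/-- **Value of `P_R`**: the cell mass. [this work] -/
theorem evalKL_PK (R : Finset (Fin 7)) (x : Fin 7 → ℝ) : evalKL 7 (PK R) x = cellProb x R := by
  rw [PK, evalKL_prodK, List.map_map, cellProb, Fin.prod_univ_def]
  congr 1
  refine List.map_congr_left fun i _ => ?_
  simp only [Function.comp]
  split_ifs
  · exact evalKL_oneSubXK i x
  · exact evalKL_XK i x

/-- Value of a mapped `sumK`. [this work] -/
theorem evalKL_sumK_map {β : Type*} (l : List β) (g : β → List (ℤ × List ℕ)) (x : Fin 7 → ℝ) :
    evalKL 7 (sumK (l.map g)) x = (l.map fun b => evalKL 7 (g b) x).sum := by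
  rw [evalKL_sumK, List.map_map]; rfl

/-- `allNodes` lists every node. [this work] -/
theorem mem_allNodes (R : Finset (Fin 7)) : R ∈ allNodes := by
  rw [allNodes, List.mem_map]
  refine ⟨(List.finRange 7).filter (· ∈ R), ?_, ?_⟩
  · exact List.mem_sublists.2 List.filter_sublist
  · ext i; simp

/-- `allPatts` lists every pattern. [this work] -/
theorem mem_allPatts (W : Finset (Fin 3)) : W ∈ allPatts := by
  rw [allPatts, List.mem_map]
  refine ⟨(List.finRange 3).filter (· ∈ W), ?_, ?_⟩
  · exact List.mem_sublists.2 List.filter_sublist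
  · ext i; simp


/-- **Value of `m_W`**: `Σ_{R : W ⊆ patt R} cellProb r R`. [this work] -/
theorem evalKL_mK (hN : allNodes.Nodup) (W : Finset (Fin 3)) (x : Fin 7 → ℝ) :
    evalKL 7 (mK W) x = ∑ R ∈ Finset.univ.filter (fun R => W ⊆ patt R), cellProb x R := by
  rw [mK, evalKL_normK, evalKL_sumK_map]
  simp only [evalKL_PK]
  rw [← List.sum_toFinset _ (hN.filter _)]
  refine Finset.sum_congr ?_ fun _ _ => rfl
  ext R
  simp [List.mem_toFinset, mem_allNodes]

/-- Value of `Cov(h_1,h_2)`. [this work] -/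
theorem evalKL_c12K (x : Fin 7 → ℝ) : evalKL 7 c12K x = evalKL 7 m12K x - evalKL 7 m1K x * evalKL 7 m2K x := by
  rw [c12K, evalKL_normK, evalKL_append, evalKL_pnegK, evalKL_pmulK]; ring
/-- Value of `Cov(h_0,h_2)`. [this work] -/
theorem evalKL_c02K (x : Fin 7 → ℝ) : evalKL 7 c02K x = evalKL 7 m02K x - evalKL 7 m0K x * evalKL 7 m2K x := by
  rw [c02K, evalKL_normK, evalKL_append, evalKL_pnegK, evalKL_pmulK]; ring
/-- Value of `Cov(h_0,h_1)`. [this work] -/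
theorem evalKL_c01K (x : Fin 7 → ℝ) : evalKL 7 c01K x = evalKL 7 m01K x - evalKL 7 m0K x * evalKL 7 m1K x := by
  rw [c01K, evalKL_normK, evalKL_append, evalKL_pnegK, evalKL_pmulK]; ring
/-- Value of `E_3`. [this work] -/
theorem evalKL_E3K (x : Fin 7 → ℝ) : evalKL 7 E3K x = 2 * evalKL 7 m012K x + evalKL 7 m0K x * evalKL 7 m1K x * evalKL 7 m2K x
    - (evalKL 7 m0K x * evalKL 7 m12K x + evalKL 7 m1K x * evalKL 7 m02K x + evalKL 7 m2K x * evalKL 7 m01K x) := by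
  rw [E3K, evalKL_normK, evalKL_sumK]
  simp only [List.map_cons, List.map_nil, List.sum_cons, List.sum_nil, evalKL_pscaleK, evalKL_pnegK, evalKL_pmulK]
  push_cast; ring

/-- **Value of `z_W`**. [this work] -/
theorem evalKL_zWK (W : Finset (Fin 3)) (x : Fin 7 → ℝ) :
    evalKL 7 (zWK W) x = 6 * (gamW {0, 1, 2} W : ℝ) - 2 * (gamW {1, 2} W : ℝ) * evalKL 7 m0K x
      - 2 * (gamW {0, 2} W : ℝ) * evalKL 7 m1K x - 2 * (gamW {0, 1} W : ℝ) * evalKL 7 m2K x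
      - (gamW {0} W : ℝ) * evalKL 7 c12K x - (gamW {1} W : ℝ) * evalKL 7 c02K x - (gamW {2} W : ℝ) * evalKL 7 c01K x
      - evalKL 7 E3K x := by
  rw [zWK, evalKL_normK, evalKL_sumK]
  simp only [List.map_cons, List.map_nil, List.sum_cons, List.sum_nil, evalKL_pscaleK, evalKL_pnegK, evalKL_oneK]
  push_cast; ring

/-- Characterisation of `inU`. [this work] -/
theorem inU_iff (D : List (Finset (Fin 7))) (R : Finset (Fin 7)) :
    inU D R = true ↔ R ∈ D ∨ (patt R = Finset.univ ∧ ∃ R0 ∈ D, R0 ⊆ R) := by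
  simp [inU, Bool.or_eq_true, Bool.and_eq_true, List.any_eq_true, decide_eq_true_eq]

/-- Value of a pattern group sum. [this work] -/
theorem evalKL_groupSum (hN : allNodes.Nodup) (D : List (Finset (Fin 7))) (W : Finset (Fin 3)) (x : Fin 7 → ℝ) :
    evalKL 7 (groupSum D W) x = ∑ R ∈ Finset.univ.filter (fun R => inU D R = true ∧ patt R = W), cellProb x R := by
  rw [groupSum, evalKL_normK, evalKL_sumK_map]
  simp only [evalKL_PK]
  rw [← List.sum_toFinset _ (hN.filter _)]
  refine Finset.sum_congr ?_ fun _ _ => rfl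
  ext R
  simp [List.mem_toFinset, mem_allNodes]

/-- **Value of the family polynomial**: `ν_𝒟(r) = Σ_{R ∈ 𝒟∪N(𝒟)} z_{patt R}(r)·cellProb r R`. [this work] -/
theorem evalKL_nuK (hN : allNodes.Nodup) (hP : allPatts.Nodup) (D : List (Finset (Fin 7))) (x : Fin 7 → ℝ) :
    evalKL 7 (nuK D) x = ∑ R ∈ Finset.univ.filter (fun R => inU D R = true), evalKL 7 (zWK (patt R)) x * cellProb x R := by
  rw [nuK, evalKL_normK, evalKL_sumK_map]
  simp only [evalKL_pmulK, evalKL_groupSum hN]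
  rw [← List.sum_toFinset _ hP]
  have hu : allPatts.toFinset = Finset.univ := by
    ext W; simp [List.mem_toFinset, mem_allPatts]
  rw [hu]
  rw [← Finset.sum_fiberwise_of_maps_to (s := Finset.univ.filter (fun R => inU D R = true)) (t := (Finset.univ : Finset (Finset (Fin 3))))
    (g := patt) (fun R _ => Finset.mem_univ _) (fun R => evalKL 7 (zWK (patt R)) x * cellProb x R)]
  refine Finset.sum_congr rfl fun W _ => ?_
  rw [Finset.mul_sum]
  have hs : Finset.univ.filter (fun R => inU D R = true ∧ patt R = W)
      = (Finset.univ.filter (fun R => inU D R = true)).filter (fun R => patt R = W) := by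
    ext R; simp [Finset.mem_filter]
  rw [hs]
  refine Finset.sum_congr rfl fun R hR => ?_
  rw [Finset.mem_filter] at hR
  rw [hR.2]

/-- The degree guard, unfolded. [this work] -/
theorem deg_of_degOK {L : List (ℤ × List ℕ)} (h : degOK L = true) : ∀ t ∈ L, ∀ vd ∈ vs7, t.2.getD vd.1 0 ≤ vd.2 := by
  intro t ht vd hvd
  rw [degOK, List.all_eq_true] at h
  have h2 := h t ht
  rw [List.all_eq_true] at h2
  exact of_decide_eq_true (h2 vd hvd)

/-- Soundness of a passed check: the polynomial is `≥ 0` on the box. [this work] -/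
theorem evalKL_nonneg_of_check {L : List (ℤ × List ℕ)} (h : (degOK L && boxcheckK vs7 L) = true)
    (x : Fin 7 → ℝ) (hx : ∀ i, 0 ≤ x i ∧ x i ≤ 1) : 0 ≤ evalKL 7 L x := by
  rw [Bool.and_eq_true] at h
  exact evalKL_nonneg_of_boxcheckK vs7 L h.2 (by decide) (deg_of_degOK h.1) x hx

/-- **From the certificate to the up-set inequalities**: if `checkAll = true` then for every `r ∈ [0,1]^7` and every up-closed family
`𝒰` of nodes, `0 ≤ Σ_{R ∈ 𝒰} z_{patt R}(r) · cellProb r R`. [this work] -/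
theorem sum_upper_nonneg_of_checkAll (hall : checkAll = true) (x : Fin 7 → ℝ) (hx : ∀ i, 0 ≤ x i ∧ x i ≤ 1)
    (U : Finset (Finset (Fin 7))) (hU : ∀ R ∈ U, ∀ R', R ⊆ R' → R' ∈ U) :
    0 ≤ ∑ R ∈ U, evalKL 7 (zWK (patt R)) x * cellProb x R := by
  rw [checkAll, Bool.and_eq_true, Bool.and_eq_true, Bool.and_eq_true] at hall
  obtain ⟨⟨hN, hP⟩, hzO, hfam⟩ := hall
  have hN' : allNodes.Nodup := of_decide_eq_true hN
  have hP' : allPatts.Nodup := of_decide_eq_true hP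
  -- the deficient part of `U`, as a sublist of `defNodes`
  set D : List (Finset (Fin 7)) := defNodes.filter (fun R => decide (R ∈ U)) with hD
  have hDmem : ∀ R, R ∈ D ↔ R ∈ defNodes ∧ R ∈ U := fun R => by
    rw [hD, List.mem_filter, decide_eq_true_iff]
  have hDfam : D ∈ families := by
    rw [families, List.mem_filter]
    refine ⟨List.mem_sublists.2 List.filter_sublist, ?_⟩
    rw [upClosedDef, List.all_eq_true]
    intro R hR
    rw [List.all_eq_true]
    intro R' hR'
    rw [Bool.or_eq_true, Bool.not_eq_true', decide_eq_false_iff_not, decide_eq_true_iff]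
    by_cases hRR' : R ⊆ R'
    · exact Or.inr ((hDmem R').2 ⟨hR', hU R ((hDmem R).1 hR).2 R' hRR'⟩)
    · exact Or.inl hRR'
  rw [List.all_eq_true] at hfam
  have h1 := evalKL_nonneg_of_check (hfam D hDfam) x hx
  rw [evalKL_nuK hN' hP'] at h1
  refine le_trans h1 (Finset.sum_le_sum_of_subset_of_nonneg (fun R hR => ?_) (fun R hRU hRn => ?_))
  · -- `𝒟 ∪ N(𝒟) ⊆ U`
    rw [Finset.mem_filter, inU_iff] at hR
    rcases hR.2 with h | ⟨_, R0, hR0, hR0R⟩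
    · exact ((hDmem R).1 h).2
    · exact hU R0 ((hDmem R0).1 hR0).2 R hR0R
  · -- the rest of `U` consists of full nodes, where `z_O · P ≥ 0`
    have hfull : patt R = Finset.univ := by
      by_contra hne
      apply hRn
      rw [Finset.mem_filter, inU_iff]
      refine ⟨Finset.mem_univ _, Or.inl ((hDmem R).2 ⟨?_, hRU⟩)⟩
      rw [defNodes, List.mem_filter]
      exact ⟨mem_allNodes R, by simpa using hne⟩
    rw [hfull]
    exact mul_nonneg (evalKL_nonneg_of_check hzO x hx) (cellProb_nonneg hx R)

end SahiFreeSlot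

end Summit.CriticalPhenomena.PercolationContinuityZ3.Theorems
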